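/-
Copyright (c) 2026 the pub-hodgecm-mathlib formalisation cell (harness21).  Prover seat hodgecm-mathlib-F0P3b-p01 (g26); E1 keeper ∕ dealer F0P3a-p03 (g31) k23∕k85
(E1 BRICK LEDGER row 68-H «K4′ SPLIT», ABSTRACT HALF; SIGSHEET-68H v1 1a8eb138).
-/
import Summits.HodgeConjecture.HodgeConjecture.Theorems.F0P3cStCharTSK4PrimeSelfExtSplitSentenceWide   -- ★ 46‴ (F0P3a-p04 g33) p853703: the K4′ SENTENCE with the widened `hJ`; `involution_ne_smul_one`
import Summits.HodgeConjecture.HodgeConjecture.Theorems.F0P3cStCharTSK4PrimeJetIntertwiner            -- ★ (O1) 2b (F0P2-p02 g27) p853695: `exists_jetIntertwiner_of_openCellJet`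
import Literature.RepresentationTheory.InvolutionOfTwoConstituents                                     -- ★ 68-B (this seat) p853660: `isCompl_of_irreducible_pair`, `exists_involution_of_isCompl`, `exists_eq_smul_one_add_smul_involution`, §0
import Literature.NumberTheory.Automorphic.JacquetOfDirectSumIsotypic                                  -- ★ 68-C (this seat) p853698: `normalizedJacquet_eq_smul_of_sup_eq_top`
import Literature.NumberTheory.Automorphic.JacquetSelfExtensionOfCharacterLine                         -- ★ 40⁗γ ED. 2 (this seat) p853662: `exists_jacquet_selfExtension_of_selfExtension_sub`
import Literature.NumberTheory.Automorphic.JacquetSelfExtensionOfInducedLine                           -- ★ 40⁗δ p853414: `exists_line_letters_of_finrank_eq_one`, `normalizedJacquet_subrepresentation_normalizedInd_eq_smul_of_finrank_eq_one`, `isSmooth_subrepresentation`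
import Literature.NumberTheory.Automorphic.JacquetFinrankSubOfQuotient                                 -- ★ 40⁗ε p853446: `finrank_coinvariants_subrepresentation_normalizedInd_eq_one`
import Literature.NumberTheory.Automorphic.AdmissibleSubquotient                                       -- ★ `Representation.IsAdmissible.of_injective`
import Literature.NumberTheory.Automorphic.RestrictedTensorProductIrreducibleProofs                     -- ★ admissible Schur `Representation.IsAdmissible.exists_eq_smul_id`
import HarnessLib

/-!
# F0 · P3c · «StCharTS» K4′ column — E1 row 68-H (ABSTRACT HALF) «EVERY SMOOTH SELF-EXTENSION OF AN L.D.S. MEMBER SPLITS»: the K4′ SENTENCE ★ 46‴ with ALL its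
# algebraic inputs DISCHARGED at an abstract parabolic triple from the realised pair `I₀ = A ⊕ A′` — modulo the height oracle, the open-cell jet datum, the additive line and
# the open kernel of occurring characters (the four datum letters, stated as hypotheses)
# [Rogawski1990, §12.2 (3) pp. 173–174; Keys1984 §3–§4; Casselman1995 §7.1; BernsteinZelevinsky1977 §2.3]

Cell `pub/hodgecm-mathlib`, crux H413 = `stmt-HodgeConjecture-24833` (`--supports` lane, `--as helper`-class: THEOREMS ONLY).  Namespace
`Summit.HodgeConjecture.HodgeConjecture.Cruxes.H413.F0P3cStCharTSLdsSelfExtSplitAbs`.  E1 BRICK LEDGER (keeper F0P3a-p03 (g31)) row 68-H, abstract half (the datum half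
`Theorems/F0P3cStCharTSLdsSelfExtSplit.lean` is ONE application at `t := cmBorelTriple L 3 v` over ★ 68-A DATUM ×2, ★ 40‴β, (M5), 68-R).

THE MATHEMATICS.  `t` a parabolic triple of `G` (`δ_P|_N = 1`, `N` a union of compact open subgroups), `χ₁` the line of a unit-valued character `χ` of `M`, `I₀ := i_P(χ₁)` admissible with
`dim r_P I₀ = 2` and no 3-chain of subrepresentations, and TWO invariant irreducible submodules `A, A′ ≤ I₀` with INEQUIVALENT restrictions, each with the SENTENCE's letters
(`hAirr`, for `A` also `hHom0`, `hSchur`) and non-zero Jacquet module of the quotient.  THEN, given (H) a height for every non-zero additive character occurring in a smooth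
`τ` (hypothesis `hHd`), (K) an open subgroup of `M` killed by every such character (`hopen`), (GL) the open-cell jet datum for every additive character with open kernel (`hGLd`)
and (R) «the additive characters with open kernel form the line of any non-zero one» (`hrank`): EVERY SMOOTH SELF-EXTENSION OF `I₀|_A` SPLITS.  Assembly: `I₀ = A ⊕ A′` (★ 68-B),
the involution `𝒜₀ = P_A − P_{A′}` and `End_G(I₀) = ℂ·1 ⊕ ℂ·𝒜₀` (★ 68-B + admissible Schur ★ + ★ 68-B §0), `dim r_P A = dim r_P A′ = 1` (★ 40⁗ε) so `r_P I₀` is `χ`-isotypic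
(★ 40⁗δ + ★ 68-C), the (b′) letters of any smooth self-extension (★ 40⁗δ + ★ 40⁗γ′), the jet intertwiner for every occurring character (★ (O1) 2b), and ★ 46‴.
* `forall_smooth_selfExtension_split_of_realisedPair` — the head (conclusion = ★ 59 trunk's `hsplit` binder shape at `I₀|_A`).
HONEST LABEL: count-neutral helper; nothing printed is asserted (the four datum letters are hypotheses; at the CM datum (H)∕(K) are ★ 40‴β, (GL) is (O1)-D's ED. 2 over (O2) FILE B,
(R) is row 68-R); h413 OPEN; HC_CM is proved only modulo the 7 printed citations (2 remaining named inputs hLiu418 = stmt-HodgeConjecture-24832, h413 = stmt-HodgeConjecture-24833) until rung 0 closes.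

## References
* [Rogawski1990] J. D. Rogawski, *Automorphic Representations of Unitary Groups in Three Variables*, Ann. of Math. Stud. 123 (1990), §12.2 (3) pp. 173–174.
* [Keys1984] D. Keys, *Principal series representations of special unitary groups over local fields*, Compositio Math. 51 (1984), §3 pp. 118–119, §4 Thm. 3 p. 120.
* [Casselman1995] W. Casselman, *Introduction to the theory of admissible representations of p-adic reductive groups* (1995), §7.1, Cor. 6.3.9 (b), Prop. 3.2.3.
* [BernsteinZelevinsky1977] I. N. Bernstein, A. V. Zelevinsky, *Induced representations of reductive p-adic groups I*, Ann. Sci. ÉNS 10 (1977), §1.8, §2.3.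
-/

set_option autoImplicit false
set_option linter.dupNamespace false

noncomputable section

open Function Representation
open Literature.NumberTheory.Automorphic Literature.RepresentationTheory
open Summit.HodgeConjecture.HodgeConjecture.Cruxes.H413

namespace Summit.HodgeConjecture.HodgeConjecture.Cruxes.H413.F0P3cStCharTSLdsSelfExtSplitAbs

variable {G : Type*} [Group G] [TopologicalSpace G] [IsTopologicalGroup G] (t : ParabolicTriple G) [LocallyCompactSpace ↥t.P]
  (hδ : ∀ (n : G) (hn : n ∈ t.N), deltaChar t.P ⟨n, t.N_le hn⟩ = 1) (hNlim : IsLimitOfCompactOpen ↥t.N)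
  (χ : ↥t.M →* ℂ) (χ₁ : Representation ℂ ↥t.M ℂ) (hχ₁ : ∀ (m : ↥t.M) (x : ℂ), χ₁ m x = χ m * x)

include hδ hNlim hχ₁ in
/-- **E1 ROW 68-H (abstract half) — EVERY SMOOTH SELF-EXTENSION OF A REALISED L.D.S. MEMBER SPLITS.**  See the module docstring; the conclusion is ★ 59 trunk's `hsplit` binder
at the sub-representation `I₀|_A` (transport to any equivalent representative by ★ 63-D). [cite: Rogawski1990, §12.2 (3) pp. 173–174] [cite: Keys1984, §3 pp. 118–119; §4 Thm. 3 p. 120]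
[cite: Casselman1995, §7.1, Cor. 6.3.9 (b), Prop. 3.2.3] [cite: BernsteinZelevinsky1977, §1.8, §2.3] -/
theorem forall_smooth_selfExtension_split_of_realisedPair (hχ : ∀ m, IsUnit (χ m))
    -- `I₀ = i_P(χ₁)`: admissible, `dim r_P I₀ = 2`, no 3-chain
    (hadm : (Representation.normalizedInd t χ₁).IsAdmissible) {K : Subgroup G} (hKo : IsOpen (K : Set G)) (hKc : IsCompact (K : Set G))
    [FiniteDimensional ℂ (t.restrict (Representation.normalizedInd t χ₁)).Coinvariants]
    (h2 : Module.finrank ℂ (t.restrict (Representation.normalizedInd t χ₁)).Coinvariants = 2)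
    (hlen : ∀ N₁ N₂ : Subrepresentation (Representation.normalizedInd t χ₁), ¬ (⊥ < N₁ ∧ N₁ < N₂ ∧ N₂ < ⊤))
    -- the member `A` (the SENTENCE's letters) and its partner `A′`
    (A : Submodule ℂ (SmoothInd t.P (Representation.twist (χ₁.comp t.proj) (rootDeltaChar t.P))))
    (hAinv : ∀ g, A ≤ A.comap (Representation.normalizedInd t χ₁ g))
    (hAirr : ∀ B : Submodule ℂ (SmoothInd t.P (Representation.twist (χ₁.comp t.proj) (rootDeltaChar t.P))), B ≤ A →
      (∀ g, B ≤ B.comap (Representation.normalizedInd t χ₁ g)) → B = ⊥ ∨ B = A)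
    (hHom0 : ∀ ψ : IntertwiningMap ((Representation.normalizedInd t χ₁).subrepresentation A hAinv) ((Representation.normalizedInd t χ₁).quotient A hAinv), ψ = 0)
    (hSchur : Module.finrank ℂ (IntertwiningMap ((Representation.normalizedInd t χ₁).subrepresentation A hAinv)
      ((Representation.normalizedInd t χ₁).subrepresentation A hAinv)) = 1)
    (hirrA : ((Representation.normalizedInd t χ₁).subrepresentation A hAinv).IsIrreducible)
    (hNT : Nontrivial (t.restrict ((Representation.normalizedInd t χ₁).quotient A hAinv)).Coinvariants)
    (A' : Submodule ℂ (SmoothInd t.P (Representation.twist (χ₁.comp t.proj) (rootDeltaChar t.P))))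
    (hA'inv : ∀ g, A' ≤ A'.comap (Representation.normalizedInd t χ₁ g))
    (hA'irr : ∀ B : Submodule ℂ (SmoothInd t.P (Representation.twist (χ₁.comp t.proj) (rootDeltaChar t.P))), B ≤ A' →
      (∀ g, B ≤ B.comap (Representation.normalizedInd t χ₁ g)) → B = ⊥ ∨ B = A')
    (hirrA' : ((Representation.normalizedInd t χ₁).subrepresentation A' hA'inv).IsIrreducible)
    (hNT' : Nontrivial (t.restrict ((Representation.normalizedInd t χ₁).quotient A' hA'inv)).Coinvariants)
    (hneq : ∀ e : ((Representation.normalizedInd t χ₁).subrepresentation A hAinv).Equiv ((Representation.normalizedInd t χ₁).subrepresentation A' hA'inv), False)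
    (hAA' : A ≠ A')
    -- (H) the height oracle for occurring characters, (K) their open kernel — per smooth `τ` (★ 40‴β at the CM datum)
    (hHd : ∀ (X : Type) [AddCommGroup X] [Module ℂ X] (τ : Representation ℂ G X), τ.IsSmooth →
      ∀ (pJ : (t.restrict τ).Coinvariants →ₗ[ℂ] ℂ) (u₀ e : (t.restrict τ).Coinvariants), pJ u₀ = 1 → pJ e = 0 → (∀ c : ℂ, c • e = 0 → c = 0) →
      ∀ (lam : ↥t.M → ℂ), lam 1 = 0 → (∀ m m' : ↥t.M, lam (m * m') = lam m + lam m') → (∃ m, lam m ≠ 0) →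
      (∀ m : ↥t.M, τ.normalizedJacquet t m u₀ - χ m • u₀ = (χ m * lam m) • e) →
      ∃ (Λ : G → ℂ) (KΛ : Subgroup G), IsOpen (KΛ : Set G) ∧ (∀ (x κ : G), κ ∈ KΛ → Λ (x * κ) = Λ x) ∧
        ∀ (q : ↥t.P) (g : G), Λ ((q : G) * g) = lam (t.proj q) + Λ g)
    (hopen : ∀ (X : Type) [AddCommGroup X] [Module ℂ X] (τ : Representation ℂ G X), τ.IsSmooth →
      ∀ (pJ : (t.restrict τ).Coinvariants →ₗ[ℂ] ℂ) (u₀ e : (t.restrict τ).Coinvariants), pJ u₀ = 1 → pJ e = 0 → (∀ c : ℂ, c • e = 0 → c = 0) →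
      ∀ (lam : ↥t.M → ℂ), (∀ m m' : ↥t.M, lam (m * m') = lam m + lam m') →
      (∀ m : ↥t.M, τ.normalizedJacquet t m u₀ - χ m • u₀ = (χ m * lam m) • e) →
      ∃ U : Subgroup ↥t.M, IsOpen (U : Set ↥t.M) ∧ ∀ m ∈ U, lam m = 0)
    -- (GL) the open-cell jet datum for every additive character with open kernel (★ (O1) 2b's frame letters; (O1)-D ED. 2 at the CM datum)
    (hGLd : ∀ (lam : ↥t.M → ℂ), lam 1 = 0 → (∀ m m' : ↥t.M, lam (m * m') = lam m + lam m') →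
      (∃ U : Subgroup ↥t.M, IsOpen (U : Set ↥t.M) ∧ ∀ m ∈ U, lam m = 0) →
      ∃ (N₀ N₀' : Representation ℂ ↥t.M (ℂ × ℂ)) (ℓ : Submodule ℂ (t.restrict (Representation.normalizedInd t N₀)).Coinvariants) (θ : ↥ℓ ≃ₗ[ℂ] (ℂ × ℂ)),
        (∀ (m : ↥t.M) (w : ℂ × ℂ), N₀ m w = (χ₁ m w.1, lam m • χ₁ m w.1 + χ₁ m w.2)) ∧
        (∀ (m : ↥t.M) (w : ℂ × ℂ), N₀' m w = (χ₁ m w.1, (-lam m) • χ₁ m w.1 + χ₁ m w.2)) ∧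
        (∀ x, x ∈ ℓ ↔ ∃ f : SmoothInd t.P (Representation.twist (N₀.comp t.proj) (rootDeltaChar t.P)),
          f.toFun 1 = 0 ∧ Coinvariants.mk (t.restrict (Representation.normalizedInd t N₀)) f = x) ∧
        (∀ (m : ↥t.M) (x : (t.restrict (Representation.normalizedInd t N₀)).Coinvariants) (hx : x ∈ ℓ)
          (hmx : (Representation.normalizedInd t N₀).normalizedJacquet t m x ∈ ℓ),
          θ ⟨(Representation.normalizedInd t N₀).normalizedJacquet t m x, hmx⟩ = N₀' m (θ ⟨x, hx⟩)) ∧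
        (∀ (S : (Representation.normalizedInd t N₀).IntertwiningMap (Representation.normalizedInd t N₀)),
          (∀ (F : SmoothInd t.P (Representation.twist (N₀.comp t.proj) (rootDeltaChar t.P))) (x : G), (S F).toFun x = (0, (F.toFun x).1)) →
          ∀ (x : (t.restrict (Representation.normalizedInd t N₀)).Coinvariants) (hx : x ∈ ℓ) (hSx : jacquetMap t S x ∈ ℓ),
            θ ⟨jacquetMap t S x, hSx⟩ = (0, (θ ⟨x, hx⟩).1)))
    -- (R) the additive characters with open kernel form the line of any non-zero one (row 68-R at the CM datum)
    (hrank : ∀ (lam : ↥t.M → ℂ), lam 1 = 0 → (∀ m m' : ↥t.M, lam (m * m') = lam m + lam m') →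
      (∃ U : Subgroup ↥t.M, IsOpen (U : Set ↥t.M) ∧ ∀ m ∈ U, lam m = 0) → (∃ m, lam m ≠ 0) →
      ∀ β : ↥t.M → ℂ, (∀ m m', β (m * m') = β m + β m') → (∃ U : Subgroup ↥t.M, IsOpen (U : Set ↥t.M) ∧ ∀ m ∈ U, β m = 0) → ∃ c : ℂ, ∀ m, β m = c * lam m) :
    ∀ (E : Type) [AddCommGroup E] [Module ℂ E] (ρE : Representation ℂ G E), ρE.IsSmooth →
      ∀ (i : ((Representation.normalizedInd t χ₁).subrepresentation A hAinv).IntertwiningMap ρE)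
        (p : ρE.IntertwiningMap ((Representation.normalizedInd t χ₁).subrepresentation A hAinv)),
        Function.Injective i → LinearMap.ker p.toLinearMap = LinearMap.range i.toLinearMap → Function.Surjective p →
          ∃ s : ((Representation.normalizedInd t χ₁).subrepresentation A hAinv).IntertwiningMap ρE,
            p.comp s = IntertwiningMap.id ((Representation.normalizedInd t χ₁).subrepresentation A hAinv) := by
  intro E _ _ ρE hE i p hi hex hp
  -- shorthand facts on the pair
  haveI := hirrA
  haveI := hirrA'
  have hA : A ≠ ⊥ := by
    haveI : Nontrivial ↥A := Representation.IsIrreducible.nontrivial ((Representation.normalizedInd t χ₁).subrepresentation A hAinv)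
    exact Submodule.nontrivial_iff_ne_bot.1 inferInstance
  have hA' : A' ≠ ⊥ := by
    haveI : Nontrivial ↥A' := Representation.IsIrreducible.nontrivial ((Representation.normalizedInd t χ₁).subrepresentation A' hA'inv)
    exact Submodule.nontrivial_iff_ne_bot.1 inferInstance
  have hI : (Representation.normalizedInd t χ₁).IsSmooth := hadm.isSmooth
  -- the direct sum and the involution (★ 68-B)
  have hc : IsCompl A A' := isCompl_of_irreducible_pair (Representation.normalizedInd t χ₁) hAinv hA'inv hAirr hA'irr hA hA' hAA' hlen
  obtain ⟨A₀, hA₀, hAfix, hA'fix, hA₀sq, -⟩ := exists_involution_of_isCompl (Representation.normalizedInd t χ₁) hAinv hA'inv hc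
  have hA₀ns : ∀ c : ℂ, A₀ ≠ c • 1 :=
    F0P3cStCharTSK4PrimeSelfExtSplitSentenceWide.involution_ne_smul_one hA₀sq (involution_ne_one A₀ hA'fix hA' two_ne_zero) (involution_ne_neg_one A₀ hAfix hA two_ne_zero)
  -- Schur on the two blocks (admissible irreducible subs) and the vanishing of the off-diagonal Homs (inequivalence)
  obtain ⟨ιA, hιA⟩ := exists_subtypeIntertwiningMap (Representation.normalizedInd t χ₁) hAinv
  obtain ⟨ιA', hιA'⟩ := exists_subtypeIntertwiningMap (Representation.normalizedInd t χ₁) hA'inv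
  have hsmA : ((Representation.normalizedInd t χ₁).subrepresentation A hAinv).IsSmooth := isSmooth_subrepresentation _ A hAinv hI
  have hsmA' : ((Representation.normalizedInd t χ₁).subrepresentation A' hA'inv).IsSmooth := isSmooth_subrepresentation _ A' hA'inv hI
  have hadmA : ((Representation.normalizedInd t χ₁).subrepresentation A hAinv).IsAdmissible :=
    IsAdmissible.of_injective hsmA ιA (fun x y hxy => Subtype.ext (by rw [← hιA x, ← hιA y, hxy])) hadm
  have hadmA' : ((Representation.normalizedInd t χ₁).subrepresentation A' hA'inv).IsAdmissible :=
    IsAdmissible.of_injective hsmA' ιA' (fun x y hxy => Subtype.ext (by rw [← hιA' x, ← hιA' y, hxy])) hadm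
  have hSchurA : ∀ S : ((Representation.normalizedInd t χ₁).subrepresentation A hAinv).IntertwiningMap ((Representation.normalizedInd t χ₁).subrepresentation A hAinv),
      ∃ c : ℂ, ∀ a, S a = c • a := fun S => by
    obtain ⟨c, hc⟩ := IsAdmissible.exists_eq_smul_id hadmA hKo hKc S.toLinearMap (fun g => S.isIntertwining' g)
    exact ⟨c, fun a => by rw [← IntertwiningMap.toLinearMap_apply, hc, LinearMap.smul_apply, LinearMap.id_apply]⟩
  have hSchurA' : ∀ S : ((Representation.normalizedInd t χ₁).subrepresentation A' hA'inv).IntertwiningMap ((Representation.normalizedInd t χ₁).subrepresentation A' hA'inv),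
      ∃ c : ℂ, ∀ a, S a = c • a := fun S => by
    obtain ⟨c, hc⟩ := IsAdmissible.exists_eq_smul_id hadmA' hKo hKc S.toLinearMap (fun g => S.isIntertwining' g)
    exact ⟨c, fun a => by rw [← IntertwiningMap.toLinearMap_apply, hc, LinearMap.smul_apply, LinearMap.id_apply]⟩
  have hHom : ∀ S : ((Representation.normalizedInd t χ₁).subrepresentation A hAinv).IntertwiningMap ((Representation.normalizedInd t χ₁).subrepresentation A' hA'inv), S = 0 :=
    fun S => intertwiningMap_eq_zero_of_forall_equiv_false hneq S
  have hHom' : ∀ S : ((Representation.normalizedInd t χ₁).subrepresentation A' hA'inv).IntertwiningMap ((Representation.normalizedInd t χ₁).subrepresentation A hAinv), S = 0 :=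
    fun S => intertwiningMap_eq_zero_of_forall_equiv_false (fun e => hneq e.symm) S
  have hEnd := exists_eq_smul_one_add_smul_involution (Representation.normalizedInd t χ₁) hAinv hA'inv hc A₀ hAfix hA'fix hSchurA hSchurA' hHom hHom'
    two_ne_zero
  -- `dim r_P A = dim r_P A′ = 1`, hence `r_P I₀` is `χ`-isotypic (★ 40⁗ε, ★ 40⁗δ, ★ 68-C)
  have h1 := finrank_coinvariants_subrepresentation_normalizedInd_eq_one t hNlim hδ χ₁ A hAinv hA h2 hNT
  have h1' := finrank_coinvariants_subrepresentation_normalizedInd_eq_one t hNlim hδ χ₁ A' hA'inv hA' h2 hNT'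
  have hcharA := normalizedJacquet_subrepresentation_normalizedInd_eq_smul_of_finrank_eq_one t hδ χ χ₁ hχ₁ A hAinv hA h1
  have hcharA' := normalizedJacquet_subrepresentation_normalizedInd_eq_smul_of_finrank_eq_one t hδ χ χ₁ hχ₁ A' hA'inv hA' h1'
  have hss := normalizedJacquet_eq_smul_of_sup_eq_top t (Representation.normalizedInd t χ₁) hAinv hA'inv (codisjoint_iff.1 hc.codisjoint) χ hcharA hcharA'
  -- the (b′) letters of the self-extension, with the sub-line conjuncts (★ 40⁗δ + ★ 40⁗γ ED. 2)
  obtain ⟨a₀, qA, hqa₀, hspan, hchar⟩ := exists_line_letters_of_finrank_eq_one t hδ χ χ₁ hχ₁ A hAinv hA h1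
  have hιJ : Function.Injective (jacquetMap t i) := jacquetMap_injective t hNlim hE i hi
  obtain ⟨pJ, u₀, e, hquot, hker, hu₀, he, hline, hfree, hιker, hιe⟩ :=
    exists_jacquet_selfExtension_of_selfExtension_sub t ((Representation.normalizedInd t χ₁).subrepresentation A hAinv) ρE χ qA hqa₀ hspan hchar i p hιJ hp hex
  -- the K4′ SENTENCE (★ 46‴) with (H) from `hHd` and (J∀occ) from ★ (O1) 2b over `hopen`, `hGLd`, `hss`, `hrank`, `hEnd`
  refine F0P3cStCharTSK4PrimeSelfExtSplitSentenceWide.selfExtension_splits_of_jacquet_selfExtension_of_jet_intertwiner t hδ χ χ₁ hχ₁ ρE hE hχ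
    A hAinv hAirr hHom0 hSchur A₀ hA₀ hAfix i p hp hex pJ hquot hker hu₀ he hline hfree hιker hιe ?_ ?_
  · -- (H)
    intro lam hlam1 hlam hne hocc
    exact hHd E ρE hE pJ u₀ e hu₀ he hfree lam hlam1 hlam hne hocc
  · -- (J∀occ)
    intro lam hlam1 hlam hne hocc Λ KΛ hKΛ hΛK hΛ π₁ hπ₁
    have hop := hopen E ρE hE pJ u₀ e hu₀ he hfree lam hlam hocc
    obtain ⟨N₀, N₀', ℓ, θ, hN₀, hN₀', hℓ, hθM, hθE⟩ := hGLd lam hlam1 hlam hop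
    have hrk := hrank lam hlam1 hlam hop hne
    exact F0P3cStCharTSK4PrimeJetIntertwiner.exists_jetIntertwiner_of_openCellJet t hδ χ χ₁ hχ₁ lam N₀ N₀' hN₀ hN₀' ℓ hℓ θ hθM hθE Λ hΛ KΛ hKΛ hΛK
      π₁ hπ₁ hχ hlam hne hss hrk A₀ hA₀sq hA₀ns hEnd

end Summit.HodgeConjecture.HodgeConjecture.Cruxes.H413.F0P3cStCharTSLdsSelfExtSplitAbs

end
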